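import Literature.NumberTheory.Automorphic.ModularEisensteinFourier
import Literature.Analysis.FunctionSpaces.PlancherelL1L2

/-!
# Eisenstein coefficients `⟨f, E(·, ½ + ir)⟩` and Eisenstein wave packets on `SL₂(ℤ)\ℍ`
(Iwaniec, *Spectral Methods of Automorphic Forms*, GSM 53, §7.1 (7.5)–(7.6), Proposition 7.1 (first
claim), §7.2 (the functions `f_𝔞`), Theorem 7.3 (7.15); PDF pp. 69–75)

Part of the `provefact` decomposition of `Literature.NumberTheory.Automorphic.Iwaniec2002_thm_7_4_modular`
(`ModularPretrace.lean`): the continuous spectrum of `L²(SL₂(ℤ)\ℍ)`. The eigenpacket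
`E(z, ½ + ir)` (`eisensteinCrit`, `ModularEisensteinCriticalLine.lean`) is not square integrable, so
the spectral coefficient of an `f ∈ L²(𝒟)` is defined by the absolutely convergent integral only for
bounded `f`, and the synthesis of a coefficient function `g(r)` — Iwaniec's *Eisenstein transform*
(7.5), here called a wave packet — is square integrable on the fundamental domain only after the
constant term is controlled by Plancherel's theorem in the horocycle variable `log y`. This file
supplies these measure-theoretic facts (everything is PROVED, nothing is vendored):

1. **Tonelli on the Roelcke strip** `S = {|x| < ½, y > √3/2} ⊇ 𝒟ᵒ` (`lintegral_roelckeStrip_eq`);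
   hence `∫⁻_𝒟 h(Im z) dμ ≤ ∫⁻_{y > √3/2} h(y) y⁻² dy` and `√(Im z) ∈ L¹(𝒟)`
   (`lintegral_fd_comp_im_le`, `lintegral_fd_sqrt_im_lt_top`).
2. **`E(·, ½ + ir) ∈ L¹(𝒟)` locally uniformly in `r`**: with `c = critFactor` and the cusp bound
   `|E(z, ½ + ir)| ≤ 2√y + |c(r)| C e^{−2πy}` of `ModularEisensteinFourier.lean`, the dominating
   function `2√(Im z) + K` is integrable on `𝒟`; `(z, r) ↦ E(z, ½ + ir)` is jointly measurable
   (separately continuous).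
3. **The Eisenstein coefficient** `eisCoef f r = ∫_𝒟 f(z) conj E(z, ½ + ir) dμ(z)` of a bounded
   measurable `f`: continuity in `r` (dominated convergence), linearity in `f`, a locally uniform
   bound, and `eisCoef f (−r) = ∫_𝒟 f E(·, ½ + ir)` (`E(z, ½ − ir) = conj E(z, ½ + ir)`).
4. **Wave packets** `eisPacket g z = ∫ g(r) E(z, ½ + ir) dr` for bounded measurable compactly
   supported profiles `g` ((7.5) without the factor `1/4π`): continuity and automorphy in `z`, the
   **pairing** `∫_𝒟 f conj(eisPacket g) dμ = ∫ conj(g r) eisCoef f r dr` (Fubini), orthogonality to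
   Maass cusp forms with real spectral parameter and to constants (from `EisensteinOrthogonality.lean`).
5. **Wave packets are square integrable on `𝒟`** (Proposition 7.1, first claim, for `SL₂(ℤ)`): the
   constant term of `eisPacket g` at height `y` is `√y (A(log y) + B(log y))` with `A, B` Fourier
   transforms of `g` and `g · φ(½ + i·)` (`|φ| = 1`), square integrable by Plancherel
   (`Literature.Analysis.FunctionSpaces.memLp_two_fourierIntegral`), and the remainder is bounded;
   hence `MemLp (eisPacket g) 2 μ𝒟` (`memLp_eisPacket`).

Mathlib: `MeasureTheory.continuousAt_of_dominated`, `measurable_uncurry_of_continuous_of_measurable`,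
`MeasureTheory.integral_integral_swap`, `Integrable.mul_prod`, `Real.fourierIntegral`,
`MeasureTheory.MemLp.of_bound`. Literature: `eisensteinCrit`, `continuous_eisensteinCrit`,
`critFactor`, `continuous_critFactor` (`ModularEisensteinCriticalLine.lean`); `norm_eisensteinCrit_le`,
`eisCT`, `eisCT_eq`, `eisRem`, `norm_eisRem_le`, `scatPhi`, `norm_scatPhi_critS`, `eisensteinCrit_neg`
(`ModularEisensteinFourier.lean`); `IsMaassCuspForm.integral_fd_conj_mul_eisensteinCrit`,
`integral_fd_eisensteinCrit_eq_zero`, `lintegral_upperHalfPlane_eq`, `setLIntegral_upperHalf_eq_iterated`,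
`invCoe_mk` (`EisensteinOrthogonality.lean`); `roelckeStrip`, `lintegral_fd_le_roelckeStrip`,
`pt_mem_roelckeStrip_iff` (`RoelckeSelbergBound.lean`); `half_le_im_of_mem_fd`,
`isFiniteMeasure_restrict_fd` (`CuspFormsCompact.lean`); `memLp_two_fourierIntegral`
(`Analysis/FunctionSpaces/PlancherelL1L2.lean`).

## References
* [Iwaniec2002] H. Iwaniec, *Spectral Methods of Automorphic Forms*, 2nd ed., GSM 53, AMS 2002,
  §7.1 (7.5)–(7.6) & Prop. 7.1, PDF pp. 69–71; §7.2, PDF p. 72; Thm 7.3 (7.15), PDF p. 75.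
-/

noncomputable section

namespace Literature.NumberTheory.Automorphic

open MeasureTheory Set Filter Real UpperHalfPlane
open scoped _root_.Topology _root_.MatrixGroups _root_.ComplexConjugate _root_.NNReal _root_.ENNReal _root_.Modular

local notation "Γℤ" => (𝒮ℒ : Subgroup (GL (Fin 2) ℝ))
local notation "μ𝒟" => MeasureTheory.Measure.restrict (volume : Measure ℍ) (ModularGroup.fd)

attribute [local instance] isFiniteMeasure_restrict_fd

/-! ## 1. Tonelli on the Roelcke strip and integrals of functions of the height over `𝒟` -/

/-- **Tonelli on the strip** `S = {|x| < ½, y > √3/2}`: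
`∫⁻_S φ dμ = ∫⁻_{y > 0} 𝟙[y > √3/2] (∫⁻_{|x| < ½} φ(x + iy) dx) y⁻² dy`. [folklore] -/
theorem lintegral_roelckeStrip_eq (φ : ℍ → ℝ≥0∞) (hφ : Measurable φ) :
    ∫⁻ z in roelckeStrip, φ z =
      ∫⁻ y in Ioi (0 : ℝ), (Ioi (Real.sqrt 3 / 2)).indicator
        (fun y => (∫⁻ x in Ioo (-(1 / 2 : ℝ)) (1 / 2), φ (pt x y)) * ENNReal.ofReal ((y ^ 2)⁻¹)) y := by
  have hSm : MeasurableSet roelckeStrip := isOpen_roelckeStrip.measurableSet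
  have hmeas : Measurable fun z : ℂ => ENNReal.ofReal ((z.im ^ 2)⁻¹) * (roelckeStrip.indicator φ) (invCoe z) :=
    (ENNReal.measurable_ofReal.comp ((Complex.measurable_im.pow_const 2).inv)).mul
      ((hφ.indicator hSm).comp measurable_invCoe)
  rw [← lintegral_indicator hSm, lintegral_upperHalfPlane_eq _ (hφ.indicator hSm),
    setLIntegral_upperHalf_eq_iterated _ hmeas]
  refine setLIntegral_congr_fun measurableSet_Ioi fun y hy => ?_
  have hy' : (0 : ℝ) < y := hy
  by_cases hys : Real.sqrt 3 / 2 < y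
  · rw [indicator_of_mem (mem_Ioi.mpr hys)]
    have hmx : Measurable fun x : ℝ => (Ioo (-(1 / 2 : ℝ)) (1 / 2)).indicator (fun x => φ (pt x y)) x :=
      (hφ.comp (continuous_pt hy').measurable).indicator measurableSet_Ioo
    rw [← lintegral_indicator measurableSet_Ioo, ← lintegral_mul_const _ hmx]
    congr 1 with x
    rw [invCoe_mk hy']
    simp only [Set.indicator]
    have hiff : pt x y ∈ roelckeStrip ↔ x ∈ Ioo (-(1 / 2 : ℝ)) (1 / 2) := by
      rw [pt_mem_roelckeStrip_iff hys, mem_Ioo, abs_lt]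
    by_cases hx : x ∈ Ioo (-(1 / 2 : ℝ)) (1 / 2)
    · rw [if_pos (hiff.mpr hx), if_pos hx, mul_comm]
    · rw [if_neg (fun h => hx (hiff.mp h)), if_neg hx, mul_zero, zero_mul]
  · rw [indicator_of_notMem (show y ∉ Ioi (Real.sqrt 3 / 2) from hys)]
    have h0 : ∀ x : ℝ, ENNReal.ofReal (((⟨x, y⟩ : ℂ).im ^ 2)⁻¹) * roelckeStrip.indicator φ (invCoe ⟨x, y⟩) = 0 := by
      intro x
      rw [invCoe_mk hy', indicator_of_notMem, mul_zero]
      intro hmem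
      exact hys (by have := hmem.2; rwa [pt_im hy'] at this)
    simp_rw [h0, lintegral_zero]

/-- **Integrals over `𝒟` of functions of the height**: `∫⁻_𝒟 h(Im z) dμ ≤ ∫⁻_{y > √3/2} h(y) y⁻² dy`
(the sections of `𝒟` have width `≤ 1`). [folklore] -/
theorem lintegral_fd_comp_im_le (h : ℝ → ℝ≥0∞) (hh : Measurable h) :
    ∫⁻ z in ModularGroup.fd, h z.im ≤ ∫⁻ y in Ioi (Real.sqrt 3 / 2), h y * ENNReal.ofReal ((y ^ 2)⁻¹) := by
  have hm : Measurable fun z : ℍ => h z.im := hh.comp UpperHalfPlane.continuous_im.measurable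
  refine (lintegral_fd_le_roelckeStrip _).trans ?_
  rw [lintegral_roelckeStrip_eq _ hm, ← lintegral_indicator measurableSet_Ioi,
    ← lintegral_indicator measurableSet_Ioi]
  refine lintegral_mono fun y => ?_
  by_cases hy : y ∈ Ioi (Real.sqrt 3 / 2)
  · have hys : Real.sqrt 3 / 2 < y := hy
    have hy0 : (0 : ℝ) < y := lt_trans (by positivity) hys
    rw [indicator_of_mem (mem_Ioi.mpr hy0), indicator_of_mem hy, indicator_of_mem hy]
    have heq : ∫⁻ x in Ioo (-(1 / 2 : ℝ)) (1 / 2), h (pt x y).im = h y := by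
      calc ∫⁻ x in Ioo (-(1 / 2 : ℝ)) (1 / 2), h (pt x y).im = ∫⁻ _x in Ioo (-(1 / 2 : ℝ)) (1 / 2), h y := by
            refine setLIntegral_congr_fun measurableSet_Ioo fun x _ => by rw [pt_im hy0]
        _ = h y * volume (Ioo (-(1 / 2 : ℝ)) (1 / 2)) := setLIntegral_const _ _
        _ = h y := by rw [Real.volume_Ioo]; norm_num
    rw [heq]
  · rw [indicator_of_notMem hy]
    by_cases hy0 : y ∈ Ioi (0 : ℝ)
    · rw [indicator_of_mem hy0, indicator_of_notMem hy]
    · rw [indicator_of_notMem hy0]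

/-- `√(Im z)` is integrable on `𝒟`: `∫⁻_𝒟 √y dμ ≤ ∫_{√3/2}^∞ y^{-3/2} dy < ∞`. [folklore] -/
theorem lintegral_fd_sqrt_im_lt_top : ∫⁻ z in ModularGroup.fd, ENNReal.ofReal (Real.sqrt z.im) < ∞ := by
  have h0 : (0 : ℝ) < Real.sqrt 3 / 2 := by positivity
  refine lt_of_le_of_lt (lintegral_fd_comp_im_le (fun y => ENNReal.ofReal (Real.sqrt y))
    (ENNReal.measurable_ofReal.comp Real.continuous_sqrt.measurable)) ?_
  have hint : IntegrableOn (fun y : ℝ => y ^ (-(3 / 2) : ℝ)) (Ioi (Real.sqrt 3 / 2)) :=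
    integrableOn_Ioi_rpow_of_lt (by norm_num) h0
  have heq : ∀ y ∈ Ioi (Real.sqrt 3 / 2), ENNReal.ofReal (Real.sqrt y) * ENNReal.ofReal ((y ^ 2)⁻¹) =
      ENNReal.ofReal (y ^ (-(3 / 2) : ℝ)) := by
    intro y hy
    have hy0 : 0 < y := lt_trans h0 hy
    rw [← ENNReal.ofReal_mul (Real.sqrt_nonneg _)]
    congr 1
    rw [Real.sqrt_eq_rpow, ← Real.rpow_natCast, ← Real.rpow_neg hy0.le, ← Real.rpow_add hy0]
    norm_num
  rw [setLIntegral_congr_fun measurableSet_Ioi heq]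
  exact hint.setLIntegral_lt_top


/-! ## 2. `E(·, ½ + ir)` on the fundamental domain: domination and joint measurability -/

/-- `𝒟` is measurable. [folklore] -/
theorem measurableSet_modular_fd : MeasurableSet ModularGroup.fd := ModularGroup.isClosed_fd.measurableSet

/-- `sup_{|r| ≤ R} |c(r)|`, finite by continuity of `c = critFactor`. [folklore] -/
def critFactorSup (R : ℝ) : ℝ := sSup ((fun r : ℝ => ‖critFactor r‖) '' Icc (-R) R)

/-- `|c(r)| ≤ sup_{|r'| ≤ R} |c(r')|` for `|r| ≤ R`. [folklore] -/
theorem norm_critFactor_le_critFactorSup {R r : ℝ} (hr : |r| ≤ R) : ‖critFactor r‖ ≤ critFactorSup R :=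
  le_csSup ((isCompact_Icc.image continuous_critFactor.norm).bddAbove) ⟨r, abs_le.mp hr, rfl⟩

/-- The supremum is non-negative (`R ≥ 0`). [folklore] -/
theorem critFactorSup_nonneg {R : ℝ} (hR : 0 ≤ R) : 0 ≤ critFactorSup R :=
  le_trans (norm_nonneg _) (norm_critFactor_le_critFactorSup (r := 0) (by simpa using hR))

/-- **The dominating function** `D_R(z) = 2√(Im z) + (sup_{|r|≤R}|c(r)|) · C(½)` of `|E(z, ½ + ir)|` on
`𝒟`, `|r| ≤ R`. [folklore] -/
def eisDom (R : ℝ) (z : ℍ) : ℝ := 2 * Real.sqrt z.im + critFactorSup R * csHConst (1 / 2)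

/-- `D_R` is continuous. [folklore] -/
theorem continuous_eisDom (R : ℝ) : Continuous (eisDom R) := by
  unfold eisDom; fun_prop

/-- `D_R ≥ 0` (`R ≥ 0`). [folklore] -/
theorem eisDom_nonneg {R : ℝ} (hR : 0 ≤ R) (z : ℍ) : 0 ≤ eisDom R z :=
  add_nonneg (by positivity) (mul_nonneg (critFactorSup_nonneg hR) (csHConst_nonneg _))

/-- **`|E(z, ½ + ir)| ≤ D_R(z)` for `z ∈ 𝒟`, `|r| ≤ R`** (the cusp bound of
`ModularEisensteinFourier.lean` with `Im z ≥ ½` on `𝒟`). [cite: Iwaniec2002, (3.20) & (3.29), PDF pp. 46–47] -/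
theorem norm_eisensteinCrit_le_eisDom {R r : ℝ} (hr : |r| ≤ R) {z : ℍ} (hz : z ∈ ModularGroup.fd) :
    ‖eisensteinCrit z r‖ ≤ eisDom R z := by
  have h := norm_eisensteinCrit_le (y₀ := 1 / 2) (by norm_num) z (half_le_im_of_mem_fd hz) r
  refine h.trans (add_le_add le_rfl ?_)
  have hC := csHConst_nonneg (1 / 2 : ℝ)
  have he : Real.exp (-(2 * Real.pi * z.im)) ≤ 1 := Real.exp_le_one_iff.mpr (by
    have := z.im_pos; nlinarith [Real.pi_pos])
  calc ‖critFactor r‖ * (csHConst (1 / 2) * Real.exp (-(2 * Real.pi * z.im)))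
      ≤ critFactorSup R * (csHConst (1 / 2) * 1) := by
        apply mul_le_mul (norm_critFactor_le_critFactorSup hr) _ (by positivity)
          (critFactorSup_nonneg (le_trans (abs_nonneg r) hr))
        exact mul_le_mul_of_nonneg_left he hC
    _ = critFactorSup R * csHConst (1 / 2) := by rw [mul_one]

/-- **`D_R ∈ L¹(𝒟)`** (`√y ∈ L¹(𝒟)` and `𝒟` has finite volume). [folklore] -/
theorem integrable_eisDom (R : ℝ) : Integrable (eisDom R) μ𝒟 := by
  have h1 : Integrable (fun z : ℍ => 2 * Real.sqrt z.im) μ𝒟 := by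
    refine Integrable.const_mul ⟨(Real.continuous_sqrt.comp UpperHalfPlane.continuous_im).aestronglyMeasurable, ?_⟩ 2
    rw [HasFiniteIntegral]
    calc ∫⁻ z in ModularGroup.fd, ‖Real.sqrt z.im‖ₑ = ∫⁻ z in ModularGroup.fd, ENNReal.ofReal (Real.sqrt z.im) := by
          refine lintegral_congr fun z => ?_
          rw [← ofReal_norm, Real.norm_of_nonneg (Real.sqrt_nonneg _)]
      _ < ∞ := lintegral_fd_sqrt_im_lt_top
  have h2 : Integrable (fun _ : ℍ => critFactorSup R * csHConst (1 / 2)) μ𝒟 := integrable_const _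
  exact h1.add h2

/-- **`(z, r) ↦ E(z, ½ + ir)` is jointly measurable** (continuous in each variable separately). [folklore] -/
theorem measurable_eisensteinCrit_uncurry : Measurable fun p : ℍ × ℝ => eisensteinCrit p.1 p.2 := by
  have h : Measurable (Function.uncurry fun (r : ℝ) (z : ℍ) => eisensteinCrit z r) :=
    measurable_uncurry_of_continuous_of_measurable (u := fun (r : ℝ) (z : ℍ) => eisensteinCrit z r)
      (fun z => continuous_eisensteinCrit z) (fun r => (isC2_and_eigen_eisensteinCrit r).1.continuous.measurable)
  have e : (fun p : ℍ × ℝ => eisensteinCrit p.1 p.2) = (Function.uncurry fun (r : ℝ) (z : ℍ) => eisensteinCrit z r) ∘ Prod.swap := by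
    funext p; rfl
  rw [e]
  exact h.comp measurable_swap

/-- `z ↦ E(z, ½ + ir)` is continuous. [folklore] -/
theorem continuous_eisensteinCrit_left (r : ℝ) : Continuous fun z : ℍ => eisensteinCrit z r :=
  (isC2_and_eigen_eisensteinCrit r).1.continuous

/-! ## 3. The Eisenstein coefficient `⟨f, E(·, ½ + ir)⟩` of a bounded function -/

/-- **The Eisenstein coefficient** `⟨f, E(·, ½ + ir)⟩ = ∫_𝒟 f(z) conj E(z, ½ + ir) dμ(z)` — the
projection of `f` on the eigenpacket in (7.15)/(7.17). [cite: Iwaniec2002, Thm 7.3 (7.15), PDF p. 75] -/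
def eisCoef (f : ℍ → ℂ) (r : ℝ) : ℂ := ∫ z in ModularGroup.fd, f z * conj (eisensteinCrit z r)

section Coef

variable {f : ℍ → ℂ} {B : ℝ}

/-- The integrand of `eisCoef` is a.e.-strongly measurable. [folklore] -/
theorem aestronglyMeasurable_mul_conj_eisensteinCrit (hf : AEStronglyMeasurable f μ𝒟) (r : ℝ) :
    AEStronglyMeasurable (fun z => f z * conj (eisensteinCrit z r)) μ𝒟 :=
  hf.mul (Complex.continuous_conj.comp (continuous_eisensteinCrit_left r)).aestronglyMeasurable

/-- **Absolute convergence**: `f · conj E(·, ½ + ir) ∈ L¹(𝒟)` for bounded measurable `f`. [folklore] -/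
theorem integrable_mul_conj_eisensteinCrit (hf : AEStronglyMeasurable f μ𝒟) (hB : ∀ z, ‖f z‖ ≤ B) (r : ℝ) :
    Integrable (fun z => f z * conj (eisensteinCrit z r)) μ𝒟 := by
  have hB0 : 0 ≤ B := le_trans (norm_nonneg _) (hB UpperHalfPlane.I)
  refine Integrable.mono' ((integrable_eisDom |r|).const_mul B) (aestronglyMeasurable_mul_conj_eisensteinCrit hf r) ?_
  filter_upwards [ae_restrict_mem measurableSet_modular_fd] with z hz
  rw [norm_mul, Complex.norm_conj]
  exact mul_le_mul (hB z) (norm_eisensteinCrit_le_eisDom le_rfl hz) (norm_nonneg _) hB0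

/-- **Locally uniform bound**: `|⟨f, E(·, ½ + ir)⟩| ≤ B ∫_𝒟 D_R` for `|r| ≤ R`. [folklore] -/
theorem norm_eisCoef_le (hB : ∀ z, ‖f z‖ ≤ B) {R r : ℝ} (hr : |r| ≤ R) :
    ‖eisCoef f r‖ ≤ B * ∫ z in ModularGroup.fd, eisDom R z := by
  have hB0 : 0 ≤ B := le_trans (norm_nonneg _) (hB UpperHalfPlane.I)
  unfold eisCoef
  rw [← integral_const_mul]
  refine norm_integral_le_of_norm_le ((integrable_eisDom R).const_mul B) ?_
  filter_upwards [ae_restrict_mem measurableSet_modular_fd] with z hz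
  rw [norm_mul, Complex.norm_conj]
  exact mul_le_mul (hB z) (norm_eisensteinCrit_le_eisDom hr hz) (norm_nonneg _) hB0

/-- **Continuity of `r ↦ ⟨f, E(·, ½ + ir)⟩`** (dominated convergence). [folklore] -/
theorem continuous_eisCoef (hf : AEStronglyMeasurable f μ𝒟) (hB : ∀ z, ‖f z‖ ≤ B) : Continuous (eisCoef f) := by
  have hB0 : 0 ≤ B := le_trans (norm_nonneg _) (hB UpperHalfPlane.I)
  refine continuous_iff_continuousAt.mpr fun r₀ => ?_
  set R : ℝ := |r₀| + 1 with hR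
  refine continuousAt_of_dominated (bound := fun z => B * eisDom R z) ?_ ?_ ((integrable_eisDom R).const_mul B) ?_
  · exact Eventually.of_forall fun r => aestronglyMeasurable_mul_conj_eisensteinCrit hf r
  · have hn : Ioo (r₀ - 1) (r₀ + 1) ∈ 𝓝 r₀ := Ioo_mem_nhds (by linarith) (by linarith)
    filter_upwards [hn] with r hr
    filter_upwards [ae_restrict_mem measurableSet_modular_fd] with z hz
    have hrR : |r| ≤ R := by
      rw [hR]
      have h1 := hr.1; have h2 := hr.2
      have : |r - r₀| ≤ 1 := abs_le.mpr ⟨by linarith, by linarith⟩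
      calc |r| = |r - r₀ + r₀| := by ring_nf
        _ ≤ |r - r₀| + |r₀| := abs_add_le _ _
        _ ≤ |r₀| + 1 := by linarith
    rw [norm_mul, Complex.norm_conj]
    exact mul_le_mul (hB z) (norm_eisensteinCrit_le_eisDom hrR hz) (norm_nonneg _) hB0
  · exact Eventually.of_forall fun z =>
      (continuous_const.mul (Complex.continuous_conj.comp (continuous_eisensteinCrit z))).continuousAt

/-- `r ↦ ⟨f, E(·, ½ + ir)⟩` is measurable. [folklore] -/
theorem aestronglyMeasurable_eisCoef (hf : AEStronglyMeasurable f μ𝒟) (hB : ∀ z, ‖f z‖ ≤ B) :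
    AEStronglyMeasurable (eisCoef f) volume :=
  (continuous_eisCoef hf hB).aestronglyMeasurable

/-- Additivity in `f`. [folklore] -/
theorem eisCoef_add {f g : ℍ → ℂ} {r : ℝ} (hf : Integrable (fun z => f z * conj (eisensteinCrit z r)) μ𝒟)
    (hg : Integrable (fun z => g z * conj (eisensteinCrit z r)) μ𝒟) :
    eisCoef (f + g) r = eisCoef f r + eisCoef g r := by
  unfold eisCoef
  rw [← integral_add hf hg]
  congr 1 with z
  simp only [Pi.add_apply]; ring

/-- Homogeneity in `f`. [folklore] -/
theorem eisCoef_smul (c : ℂ) (f : ℍ → ℂ) (r : ℝ) : eisCoef (c • f) r = c * eisCoef f r := by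
  unfold eisCoef
  rw [← integral_const_mul]
  congr 1 with z
  simp only [Pi.smul_apply, smul_eq_mul]; ring

/-- Subtraction in `f`. [folklore] -/
theorem eisCoef_sub {f g : ℍ → ℂ} {r : ℝ} (hf : Integrable (fun z => f z * conj (eisensteinCrit z r)) μ𝒟)
    (hg : Integrable (fun z => g z * conj (eisensteinCrit z r)) μ𝒟) :
    eisCoef (f - g) r = eisCoef f r - eisCoef g r := by
  unfold eisCoef
  rw [← integral_sub hf hg]
  congr 1 with z
  simp only [Pi.sub_apply]; ring

/-- **`⟨f, E(·, ½ − ir)⟩ = ∫_𝒟 f E(·, ½ + ir)`** (`E(z, ½ − ir) = conj E(z, ½ + ir)` for `SL₂(ℤ)`).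
[cite: Iwaniec2002, (3.31), PDF p. 47] -/
theorem eisCoef_neg (f : ℍ → ℂ) (r : ℝ) : eisCoef f (-r) = ∫ z in ModularGroup.fd, f z * eisensteinCrit z r := by
  unfold eisCoef
  congr 1 with z
  rw [eisensteinCrit_neg, Complex.conj_conj]

/-- The coefficient of the zero function vanishes. [folklore] -/
theorem eisCoef_zero (r : ℝ) : eisCoef (0 : ℍ → ℂ) r = 0 := by
  simp [eisCoef]

end Coef

/-! ## 4. Eisenstein wave packets -/

/-- **Eisenstein wave packet** of a profile `g`: `(E g)(z) = ∫ g(r) E(z, ½ + ir) dr` — Iwaniec's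
Eisenstein transform (7.5) without the normalising factor `1/4π` (and over all real `r`).
[cite: Iwaniec2002, (7.5), PDF p. 69] -/
def eisPacket (g : ℝ → ℂ) (z : ℍ) : ℂ := ∫ r, g r * eisensteinCrit z r

section Packet

variable {g : ℝ → ℂ} {M R : ℝ}

/-- Outside `[-R, R]` one has `|r| > R`. [folklore] -/
theorem lt_abs_of_not_mem_Icc {R r : ℝ} (h : r ∉ Icc (-R) R) : R < |r| := by
  rw [mem_Icc, not_and_or, not_le, not_le] at h
  rcases h with h | h
  · exact lt_of_lt_of_le (by linarith) (neg_le_abs r)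
  · exact lt_of_lt_of_le h (le_abs_self r)

/-- A bounded profile supported in `[-R, R]` is dominated by `M 𝟙_{[-R,R]}`. [folklore] -/
theorem norm_profile_le (hM : ∀ r, ‖g r‖ ≤ M) (hR : ∀ r, R < |r| → g r = 0) (r : ℝ) :
    ‖g r‖ ≤ (Icc (-R) R).indicator (fun _ => M) r := by
  by_cases h : r ∈ Icc (-R) R
  · rw [indicator_of_mem h]; exact hM r
  · rw [indicator_of_notMem h, hR r (lt_abs_of_not_mem_Icc h), norm_zero]

/-- The dominating profile `M 𝟙_{[-R,R]}` is integrable. [folklore] -/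
theorem integrable_indicator_const (M R : ℝ) : Integrable ((Icc (-R) R).indicator fun _ : ℝ => M) volume :=
  (continuous_const.integrableOn_Icc (a := -R) (b := R)).integrable_indicator measurableSet_Icc

/-- **The packet integrand is integrable in `r`** for every `z`. [folklore] -/
theorem integrable_profile_mul_eisensteinCrit (hg : AEStronglyMeasurable g volume) (hM : ∀ r, ‖g r‖ ≤ M)
    (hR : ∀ r, R < |r| → g r = 0) (z : ℍ) : Integrable (fun r => g r * eisensteinCrit z r) volume := by
  -- bound `|E(z, r)| ≤ 2√y + |c r| C(y/2) ≤ K` on `|r| ≤ R`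
  have hy := z.im_pos
  set K : ℝ := 2 * Real.sqrt z.im + critFactorSup R * csHConst (z.im / 2) with hK
  refine Integrable.mono' ((integrable_indicator_const (M * K) R)) (hg.mul (continuous_eisensteinCrit z).aestronglyMeasurable) ?_
  refine Eventually.of_forall fun r => ?_
  by_cases hr : r ∈ Icc (-R) R
  · rw [indicator_of_mem hr, norm_mul]
    have hrR : |r| ≤ R := abs_le.mpr hr
    have hE := norm_eisensteinCrit_le (y₀ := z.im / 2) (by positivity) z (by linarith) r
    have hM0 : 0 ≤ M := le_trans (norm_nonneg _) (hM 0)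
    refine mul_le_mul (hM r) (hE.trans ?_) (norm_nonneg _) hM0
    rw [hK]
    refine add_le_add le_rfl ?_
    have hC := csHConst_nonneg (z.im / 2)
    have he : Real.exp (-(2 * Real.pi * z.im)) ≤ 1 := Real.exp_le_one_iff.mpr (by nlinarith [Real.pi_pos])
    calc ‖critFactor r‖ * (csHConst (z.im / 2) * Real.exp (-(2 * Real.pi * z.im)))
        ≤ critFactorSup R * (csHConst (z.im / 2) * 1) :=
          mul_le_mul (norm_critFactor_le_critFactorSup hrR) (mul_le_mul_of_nonneg_left he hC) (by positivity)
            (critFactorSup_nonneg (le_trans (abs_nonneg r) hrR))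
      _ = critFactorSup R * csHConst (z.im / 2) := by rw [mul_one]
  · rw [indicator_of_notMem hr, hR r (lt_abs_of_not_mem_Icc hr), zero_mul, norm_zero]

/-- **Continuity of wave packets in `z`** (dominated convergence, the bound being uniform for `z` in
`{y₀/2 < Im z < 2y₀}`). [cite: Iwaniec2002, (7.5)–(7.6), PDF p. 69] -/
theorem continuous_eisPacket (hg : AEStronglyMeasurable g volume) (hM : ∀ r, ‖g r‖ ≤ M)
    (hR : ∀ r, R < |r| → g r = 0) : Continuous (eisPacket g) := by
  refine continuous_iff_continuousAt.mpr fun z₀ => ?_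
  have hy₀ := z₀.im_pos
  have hM0 : 0 ≤ M := le_trans (norm_nonneg _) (hM 0)
  set K : ℝ := 2 * Real.sqrt (2 * z₀.im) + critFactorSup R * csHConst (z₀.im / 2) with hK
  refine continuousAt_of_dominated (μ := volume) (F := fun z r => g r * eisensteinCrit z r)
    (bound := fun r => (Icc (-R) R).indicator (fun _ => M * K) r) ?_ ?_ (integrable_indicator_const _ _) ?_
  · exact Eventually.of_forall fun z => hg.mul (continuous_eisensteinCrit z).aestronglyMeasurable
  · have hV : {z : ℍ | z₀.im / 2 < z.im ∧ z.im < 2 * z₀.im} ∈ 𝓝 z₀ := by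
      refine IsOpen.mem_nhds ?_ ⟨by show z₀.im / 2 < z₀.im; linarith, by show z₀.im < 2 * z₀.im; linarith⟩
      exact (isOpen_lt continuous_const UpperHalfPlane.continuous_im).inter
        (isOpen_lt UpperHalfPlane.continuous_im continuous_const)
    filter_upwards [hV] with z hz
    refine Eventually.of_forall fun r => ?_
    by_cases hr : r ∈ Icc (-R) R
    · rw [indicator_of_mem hr, norm_mul]
      have hrR : |r| ≤ R := abs_le.mpr hr
      have hE := norm_eisensteinCrit_le (y₀ := z₀.im / 2) (by positivity) z hz.1.le r
      refine mul_le_mul (hM r) (hE.trans ?_) (norm_nonneg _) hM0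
      rw [hK]
      refine add_le_add ?_ ?_
      · exact mul_le_mul_of_nonneg_left (Real.sqrt_le_sqrt hz.2.le) zero_le_two
      · have hC := csHConst_nonneg (z₀.im / 2)
        have he : Real.exp (-(2 * Real.pi * z.im)) ≤ 1 :=
          Real.exp_le_one_iff.mpr (by have := z.im_pos; nlinarith [Real.pi_pos])
        calc ‖critFactor r‖ * (csHConst (z₀.im / 2) * Real.exp (-(2 * Real.pi * z.im)))
            ≤ critFactorSup R * (csHConst (z₀.im / 2) * 1) :=
              mul_le_mul (norm_critFactor_le_critFactorSup hrR) (mul_le_mul_of_nonneg_left he hC) (by positivity)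
                (critFactorSup_nonneg (le_trans (abs_nonneg r) hrR))
          _ = critFactorSup R * csHConst (z₀.im / 2) := by rw [mul_one]
    · rw [indicator_of_notMem hr, hR r (lt_abs_of_not_mem_Icc hr), zero_mul, norm_zero]
  · exact Eventually.of_forall fun r => (continuous_const.mul (continuous_eisensteinCrit_left r)).continuousAt

/-- **Automorphy of wave packets.** [cite: Iwaniec2002, §7.1, PDF p. 69] -/
theorem eisPacket_smul {γ : GL (Fin 2) ℝ} (hγ : γ ∈ Γℤ) (g : ℝ → ℂ) (z : ℍ) :
    eisPacket g (γ • z) = eisPacket g z := by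
  unfold eisPacket
  congr 1 with r
  have h := isAutomorphic_eisensteinCrit r γ hγ z
  simp only at h
  rw [h]

/-- Wave packets are automorphic functions. [cite: Iwaniec2002, §7.1, PDF p. 69] -/
theorem isAutomorphic_eisPacket (g : ℝ → ℂ) : IsAutomorphic Γℤ (eisPacket g) :=
  fun _ hγ z => eisPacket_smul hγ g z

/-- Wave packets are measurable on `𝒟`. [folklore] -/
theorem aestronglyMeasurable_eisPacket (hg : AEStronglyMeasurable g volume) (hM : ∀ r, ‖g r‖ ≤ M)
    (hR : ∀ r, R < |r| → g r = 0) : AEStronglyMeasurable (eisPacket g) μ𝒟 :=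
  (continuous_eisPacket hg hM hR).aestronglyMeasurable

/-- **The Fubini majorant**: for a kernel `K(z, r)` on `𝒟 × ℝ` dominated by `D_R(z)` on `|r| ≤ R`,
`f(z) g(r) K(z, r) ∈ L¹(𝒟 × ℝ)` when `|f| ≤ B` and `g` is a bounded profile supported in `[-R, R]`. [folklore] -/
theorem integrable_prod_of_dominated {f : ℍ → ℂ} {B : ℝ} {K : ℍ → ℝ → ℂ}
    (hK : AEStronglyMeasurable (fun p : ℍ × ℝ => K p.1 p.2) ((μ𝒟).prod volume))
    (hKle : ∀ z ∈ ModularGroup.fd, ∀ r, |r| ≤ R → ‖K z r‖ ≤ eisDom R z)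
    (hf : AEStronglyMeasurable f μ𝒟) (hB : ∀ z, ‖f z‖ ≤ B) (hg : AEStronglyMeasurable g volume)
    (hM : ∀ r, ‖g r‖ ≤ M) (hR : ∀ r, R < |r| → g r = 0) :
    Integrable (fun p : ℍ × ℝ => f p.1 * (g p.2 * K p.1 p.2)) ((μ𝒟).prod volume) := by
  have hB0 : 0 ≤ B := le_trans (norm_nonneg _) (hB UpperHalfPlane.I)
  have hM0 : 0 ≤ M := le_trans (norm_nonneg _) (hM 0)
  have hmaj : Integrable (fun p : ℍ × ℝ => (B * eisDom R p.1) * (Icc (-R) R).indicator (fun _ => M) p.2)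
      ((μ𝒟).prod volume) :=
    ((integrable_eisDom R).const_mul B).mul_prod (integrable_indicator_const M R)
  refine hmaj.mono' (hf.comp_fst.mul (hg.comp_snd.mul hK)) ?_
  have hS : ∀ᵐ p : ℍ × ℝ ∂((μ𝒟).prod volume), p.1 ∈ ModularGroup.fd := by
    have e : ((μ𝒟).prod (volume : Measure ℝ)) = ((volume : Measure ℍ).prod (volume : Measure ℝ)).restrict
        (ModularGroup.fd ×ˢ (univ : Set ℝ)) := by
      rw [← Measure.prod_restrict, Measure.restrict_univ]
    rw [e]
    filter_upwards [ae_restrict_mem (measurableSet_modular_fd.prod MeasurableSet.univ)] with p hp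
    exact hp.1
  filter_upwards [hS] with p hp
  rw [norm_mul, norm_mul]
  by_cases hr : p.2 ∈ Icc (-R) R
  · rw [indicator_of_mem hr]
    have hrR : |p.2| ≤ R := abs_le.mpr hr
    calc ‖f p.1‖ * (‖g p.2‖ * ‖K p.1 p.2‖) ≤ B * (M * eisDom R p.1) :=
          mul_le_mul (hB _) (mul_le_mul (hM _) (hKle _ hp _ hrR) (norm_nonneg _) hM0) (by positivity) hB0
      _ = B * eisDom R p.1 * M := by ring
  · rw [indicator_of_notMem hr, hR _ (lt_abs_of_not_mem_Icc hr), norm_zero, zero_mul, mul_zero, mul_zero]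
    
/-- The kernel `E(z, ½ + ir)` satisfies the hypotheses of `integrable_prod_of_dominated`. [folklore] -/
theorem aestronglyMeasurable_eisensteinCrit_prod :
    AEStronglyMeasurable (fun p : ℍ × ℝ => eisensteinCrit p.1 p.2) ((μ𝒟).prod volume) :=
  measurable_eisensteinCrit_uncurry.aestronglyMeasurable

/-- The conjugate kernel is jointly measurable as well. [folklore] -/
theorem aestronglyMeasurable_conj_eisensteinCrit_prod :
    AEStronglyMeasurable (fun p : ℍ × ℝ => conj (eisensteinCrit p.1 p.2)) ((μ𝒟).prod volume) :=
  (Complex.continuous_conj.measurable.comp measurable_eisensteinCrit_uncurry).aestronglyMeasurable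

/-- **The pairing of a bounded function with a wave packet** (Fubini):
`∫_𝒟 f conj(E g) dμ = ∫ conj(g r) ⟨f, E(·, ½ + ir)⟩ dr`. [cite: Iwaniec2002, §7.2 (⟨f, f_𝔞⟩), PDF p. 72] -/
theorem integral_fd_mul_conj_eisPacket {f : ℍ → ℂ} {B : ℝ} (hf : AEStronglyMeasurable f μ𝒟) (hB : ∀ z, ‖f z‖ ≤ B)
    (hg : AEStronglyMeasurable g volume) (hM : ∀ r, ‖g r‖ ≤ M) (hR : ∀ r, R < |r| → g r = 0) :
    ∫ z in ModularGroup.fd, f z * conj (eisPacket g z) = ∫ r, conj (g r) * eisCoef f r := by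
  have hconj : ∀ z, conj (eisPacket g z) = ∫ r, conj (g r) * conj (eisensteinCrit z r) := by
    intro z
    unfold eisPacket
    rw [← integral_conj]
    congr 1 with r
    rw [map_mul]
  have lhs : ∫ z in ModularGroup.fd, f z * conj (eisPacket g z) =
      ∫ z in ModularGroup.fd, ∫ r, f z * (conj (g r) * conj (eisensteinCrit z r)) := by
    congr 1 with z
    rw [hconj, ← integral_const_mul]
  have rhs : ∫ r, conj (g r) * eisCoef f r = ∫ r, ∫ z in ModularGroup.fd, f z * (conj (g r) * conj (eisensteinCrit z r)) := by
    congr 1 with r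
    unfold eisCoef
    rw [← integral_const_mul]
    congr 1 with z
    ring
  rw [lhs, rhs]
  have hgc : AEStronglyMeasurable (fun r => conj (g r)) volume := Complex.continuous_conj.comp_aestronglyMeasurable hg
  have hint := integrable_prod_of_dominated (K := fun z r => conj (eisensteinCrit z r))
    aestronglyMeasurable_conj_eisensteinCrit_prod
    (fun z hz r hr => by rw [Complex.norm_conj]; exact norm_eisensteinCrit_le_eisDom hr hz)
    hf hB hgc (fun r => by rw [Complex.norm_conj]; exact hM r) (fun r hr => by rw [hR r hr, map_zero])
  exact integral_integral_swap hint

/-- **Wave packets are orthogonal to Maass cusp forms** (with real spectral parameter, square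
integrable on `𝒟`). [cite: Iwaniec2002, §7.1 (orthogonality of `𝓔_𝔞` and `𝓒`), PDF p. 71] -/
theorem integral_fd_conj_mul_eisPacket_eq_zero {u : ℍ → ℂ} {t : ℂ} (h : IsMaassCuspForm u t)
    (hL2 : IntegrableOn (fun z => ‖u z‖ ^ 2) ModularGroup.fd) (ht : t.im = 0)
    (hg : AEStronglyMeasurable g volume) (hM : ∀ r, ‖g r‖ ≤ M) (hR : ∀ r, R < |r| → g r = 0) :
    ∫ z in ModularGroup.fd, conj (u z) * eisPacket g z = 0 := by
  obtain ⟨Bu, hBu⟩ := h.exists_bound hL2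
  have huc : AEStronglyMeasurable (fun z => conj (u z)) μ𝒟 :=
    (Complex.continuous_conj.comp h.continuous).aestronglyMeasurable
  have lhs : ∫ z in ModularGroup.fd, conj (u z) * eisPacket g z =
      ∫ z in ModularGroup.fd, ∫ r, conj (u z) * (g r * eisensteinCrit z r) := by
    congr 1 with z
    unfold eisPacket
    rw [← integral_const_mul]
  have hint := integrable_prod_of_dominated (K := fun z r => eisensteinCrit z r)
    aestronglyMeasurable_eisensteinCrit_prod (fun z hz r hr => norm_eisensteinCrit_le_eisDom hr hz)
    huc (fun z => by rw [Complex.norm_conj]; exact hBu z) hg hM hR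
  rw [lhs, integral_integral_swap hint]
  have hvan : ∀ r : ℝ, r ≠ 0 → ∫ z in ModularGroup.fd, conj (u z) * (g r * eisensteinCrit z r) = 0 := by
    intro r hr
    have h0 := h.integral_fd_conj_mul_eisensteinCrit hL2 ht hr
    calc ∫ z in ModularGroup.fd, conj (u z) * (g r * eisensteinCrit z r)
        = g r * ∫ z in ModularGroup.fd, conj (u z) * eisensteinCrit z r := by
          rw [← integral_const_mul]; congr 1 with z; ring
      _ = 0 := by rw [h0, mul_zero]
  refine integral_eq_zero_of_ae ?_
  have hne : ∀ᵐ r : ℝ, r ≠ 0 := by rw [ae_iff]; simp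
  filter_upwards [hne] with r hr
  exact hvan r hr

/-- **Wave packets are orthogonal to constants**: `∫_𝒟 E g dμ = 0`. [cite: Iwaniec2002, §7.1, PDF p. 71] -/
theorem integral_fd_eisPacket (hg : AEStronglyMeasurable g volume) (hM : ∀ r, ‖g r‖ ≤ M)
    (hR : ∀ r, R < |r| → g r = 0) : ∫ z in ModularGroup.fd, eisPacket g z = 0 := by
  have lhs : ∫ z in ModularGroup.fd, eisPacket g z =
      ∫ z in ModularGroup.fd, ∫ r, (1 : ℂ) * (g r * eisensteinCrit z r) := by
    congr 1 with z
    unfold eisPacket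
    congr 1 with r
    rw [one_mul]
  have hint := integrable_prod_of_dominated (K := fun z r => eisensteinCrit z r) (f := fun _ => (1 : ℂ)) (B := 1)
    aestronglyMeasurable_eisensteinCrit_prod (fun z hz r hr => norm_eisensteinCrit_le_eisDom hr hz)
    aestronglyMeasurable_const (fun z => by simp) hg hM hR
  rw [lhs, integral_integral_swap hint]
  have hvan : ∀ r : ℝ, r ≠ 0 → ∫ z in ModularGroup.fd, (1 : ℂ) * (g r * eisensteinCrit z r) = 0 := by
    intro r hr
    calc ∫ z in ModularGroup.fd, (1 : ℂ) * (g r * eisensteinCrit z r)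
        = g r * ∫ z in ModularGroup.fd, eisensteinCrit z r := by
          rw [← integral_const_mul]; congr 1 with z; ring
      _ = 0 := by rw [integral_fd_eisensteinCrit_eq_zero hr, mul_zero]
  refine integral_eq_zero_of_ae ?_
  have hne : ∀ᵐ r : ℝ, r ≠ 0 := by rw [ae_iff]; simp
  filter_upwards [hne] with r hr
  exact hvan r hr

end Packet

/-! ## 5. Square integrability of wave packets on `𝒟` -/

section MemLp

open FourierTransform

variable {g : ℝ → ℂ} {M R : ℝ}

/-- A bounded profile supported in `[-R, R]` is integrable. [folklore] -/
theorem integrable_profile (hg : AEStronglyMeasurable g volume) (hM : ∀ r, ‖g r‖ ≤ M)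
    (hR : ∀ r, R < |r| → g r = 0) : Integrable g volume :=
  (integrable_indicator_const M R).mono' hg (Eventually.of_forall (norm_profile_le hM hR))

/-- A bounded profile supported in `[-R, R]` is in `L²`. [folklore] -/
theorem memLp_two_profile (hg : AEStronglyMeasurable g volume) (hM : ∀ r, ‖g r‖ ≤ M)
    (hR : ∀ r, R < |r| → g r = 0) : MemLp g 2 volume := by
  have hM0 : 0 ≤ M := le_trans (norm_nonneg _) (hM 0)
  refine (memLp_two_iff_integrable_sq_norm hg).2 ?_
  refine (integrable_indicator_const (M ^ 2) R).mono' (hg.norm.pow 2) (Eventually.of_forall fun r => ?_)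
  rw [Real.norm_of_nonneg (sq_nonneg _)]
  by_cases h : r ∈ Icc (-R) R
  · rw [indicator_of_mem h]
    exact pow_le_pow_left₀ (norm_nonneg _) (hM r) 2
  · rw [indicator_of_notMem h, hR r (lt_abs_of_not_mem_Icc h), norm_zero]
    norm_num

/-- The profile twisted by the unimodular `φ(½ + ir)` is again a bounded profile. [folklore] -/
theorem twisted_profile (hg : AEStronglyMeasurable g volume) (hM : ∀ r, ‖g r‖ ≤ M)
    (hR : ∀ r, R < |r| → g r = 0) :
    AEStronglyMeasurable (fun r => g r * scatPhi (critS r)) volume ∧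
      (∀ r, ‖g r * scatPhi (critS r)‖ ≤ M) ∧ (∀ r, R < |r| → g r * scatPhi (critS r) = 0) := by
  refine ⟨hg.mul ?_, fun r => ?_, fun r hr => by rw [hR r hr, zero_mul]⟩
  · have hc : Continuous fun r : ℝ => scatPhi (critS r) :=
      continuous_iff_continuousAt.mpr fun r =>
        (differentiableAt_scatPhi_of_half_le_re (s := critS r) (by simp [critS]) (critS_ne_one r)).continuousAt.comp
          continuous_critS.continuousAt
    exact hc.aestronglyMeasurable
  · rw [norm_mul, norm_scatPhi_critS, mul_one]; exact hM r

/-- **The transform `A(v) = ∫ g(r) e^{irv} dr = 𝓕g(−v/2π)`** entering the constant term of a packet. [folklore] -/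
def packetA (g : ℝ → ℂ) (v : ℝ) : ℂ := 𝓕 g ((-(2 * π)⁻¹) * v)

/-- **The transform `B(v) = ∫ g(r) φ(½+ir) e^{−irv} dr = 𝓕(gφ)(v/2π)`**. [folklore] -/
def packetB (g : ℝ → ℂ) (v : ℝ) : ℂ := 𝓕 (fun r => g r * scatPhi (critS r)) ((2 * π)⁻¹ * v)

/-- `A(v) = ∫ g(r) e^{i r v} dr`. [folklore] -/
theorem packetA_eq (g : ℝ → ℂ) (v : ℝ) : packetA g v = ∫ r, g r * Complex.exp (Complex.I * r * v) := by
  unfold packetA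
  rw [Real.fourier_real_eq_integral_exp_smul]
  congr 1 with r
  rw [smul_eq_mul, mul_comm]
  congr 2
  push_cast
  field_simp

/-- `B(v) = ∫ g(r) φ(½ + ir) e^{-i r v} dr`. [folklore] -/
theorem packetB_eq (g : ℝ → ℂ) (v : ℝ) :
    packetB g v = ∫ r, g r * scatPhi (critS r) * Complex.exp (-(Complex.I * r * v)) := by
  unfold packetB
  rw [Real.fourier_real_eq_integral_exp_smul]
  congr 1 with r
  rw [smul_eq_mul, mul_comm]
  congr 2
  push_cast
  field_simp

/-- Pulling an `L²` function back along `v ↦ a v` (`a ≠ 0`) keeps it in `L²`. [folklore] -/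
theorem memLp_two_comp_mul_left {F : ℝ → ℂ} (hF : MemLp F 2 volume) {a : ℝ} (ha : a ≠ 0) :
    MemLp (fun v => F (a * v)) 2 volume := by
  have hmap : Measure.map (fun x : ℝ => a * x) volume = ENNReal.ofReal |a⁻¹| • (volume : Measure ℝ) :=
    Real.map_volume_mul_left ha
  have h1 : MemLp F 2 (Measure.map (fun x : ℝ => a * x) volume) := by
    rw [hmap]; exact hF.smul_measure ENNReal.ofReal_ne_top
  exact h1.comp_of_map (measurable_const_mul a).aemeasurable

/-- `A ∈ L²(ℝ)` (Plancherel for the `L¹ ∩ L²` profile). [folklore] -/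
theorem memLp_two_packetA (hg : AEStronglyMeasurable g volume) (hM : ∀ r, ‖g r‖ ≤ M)
    (hR : ∀ r, R < |r| → g r = 0) : MemLp (packetA g) 2 volume := by
  have h := Literature.Analysis.FunctionSpaces.memLp_two_fourierIntegral (integrable_profile hg hM hR)
    (memLp_two_profile hg hM hR)
  exact memLp_two_comp_mul_left h (by have := Real.pi_pos; exact neg_ne_zero.mpr (inv_ne_zero (by positivity)))

/-- `B ∈ L²(ℝ)`. [folklore] -/
theorem memLp_two_packetB (hg : AEStronglyMeasurable g volume) (hM : ∀ r, ‖g r‖ ≤ M)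
    (hR : ∀ r, R < |r| → g r = 0) : MemLp (packetB g) 2 volume := by
  obtain ⟨h1, h2, h3⟩ := twisted_profile hg hM hR
  have h := Literature.Analysis.FunctionSpaces.memLp_two_fourierIntegral (integrable_profile h1 h2 h3)
    (memLp_two_profile h1 h2 h3)
  exact memLp_two_comp_mul_left h (by have := Real.pi_pos; exact inv_ne_zero (by positivity))

/-- `A` and `B` are continuous. [folklore] -/
theorem continuous_packetA (hg : AEStronglyMeasurable g volume) (hM : ∀ r, ‖g r‖ ≤ M)
    (hR : ∀ r, R < |r| → g r = 0) : Continuous (packetA g) :=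
  (Literature.Analysis.FunctionSpaces.continuous_fourierIntegral (integrable_profile hg hM hR)).comp
    (continuous_const.mul continuous_id)

/-- `B` is continuous. [folklore] -/
theorem continuous_packetB (hg : AEStronglyMeasurable g volume) (hM : ∀ r, ‖g r‖ ≤ M)
    (hR : ∀ r, R < |r| → g r = 0) : Continuous (packetB g) := by
  obtain ⟨h1, h2, h3⟩ := twisted_profile hg hM hR
  exact (Literature.Analysis.FunctionSpaces.continuous_fourierIntegral (integrable_profile h1 h2 h3)).comp
    (continuous_const.mul continuous_id)

/-- **The constant term of a packet**: `∫ g(r) e(y, r) dr` with `e(y, r)` the constant term of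
`E(·, ½ + ir)`. [cite: Iwaniec2002, (7.6), PDF p. 69] -/
def packetCT (g : ℝ → ℂ) (y : ℝ) : ℂ := ∫ r, g r * eisCT y r

/-- **The remainder of a packet**: `∫ g(r) N(z, r) dr`. [folklore] -/
def packetRem (g : ℝ → ℂ) (z : ℍ) : ℂ := ∫ r, g r * eisRem z r

/-- `y^{½ + ir} = √y e^{i r log y}` (`y > 0`). [folklore] -/
theorem cpow_critS_eq {y : ℝ} (hy : 0 < y) (r : ℝ) :
    ((y : ℝ) : ℂ) ^ (critS r) = (Real.sqrt y : ℂ) * Complex.exp (Complex.I * r * Real.log y) := by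
  have hyc : ((y : ℝ) : ℂ) ≠ 0 := by exact_mod_cast hy.ne'
  unfold critS
  rw [Complex.cpow_add _ _ hyc]
  congr 1
  · rw [Real.sqrt_eq_rpow, Complex.ofReal_cpow hy.le]; push_cast; rfl
  · rw [Complex.cpow_def_of_ne_zero hyc, ← Complex.ofReal_log hy.le]; ring_nf

/-- `y^{1 − (½ + ir)} = √y e^{-i r log y}` (`y > 0`). [folklore] -/
theorem cpow_one_sub_critS_eq {y : ℝ} (hy : 0 < y) (r : ℝ) :
    ((y : ℝ) : ℂ) ^ (1 - critS r) = (Real.sqrt y : ℂ) * Complex.exp (-(Complex.I * r * Real.log y)) := by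
  rw [one_sub_critS, cpow_critS_eq hy]; push_cast; ring_nf

/-- **The constant term through `A` and `B`**: `∫ g(r) e(y, r) dr = √y (A(log y) + B(log y))`. [folklore] -/
theorem packetCT_eq (hg : AEStronglyMeasurable g volume) (hM : ∀ r, ‖g r‖ ≤ M)
    (hR : ∀ r, R < |r| → g r = 0) {y : ℝ} (hy : 0 < y) :
    packetCT g y = (Real.sqrt y : ℂ) * (packetA g (Real.log y) + packetB g (Real.log y)) := by
  set v : ℝ := Real.log y with hv
  obtain ⟨h1, h2, h3⟩ := twisted_profile hg hM hR
  -- integrands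
  have hi1 : Integrable (fun r => g r * Complex.exp (Complex.I * r * v)) volume := by
    refine (integrable_indicator_const M R).mono' (hg.mul (Continuous.aestronglyMeasurable (by fun_prop)))
      (Eventually.of_forall fun r => ?_)
    rw [norm_mul, Complex.norm_exp]
    have : (Complex.I * r * v).re = 0 := by simp
    rw [this, Real.exp_zero, mul_one]
    exact norm_profile_le hM hR r
  have hi2 : Integrable (fun r => g r * scatPhi (critS r) * Complex.exp (-(Complex.I * r * v))) volume := by
    refine (integrable_indicator_const M R).mono' (h1.mul (Continuous.aestronglyMeasurable (by fun_prop)))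
      (Eventually.of_forall fun r => ?_)
    rw [norm_mul, Complex.norm_exp]
    have : (-(Complex.I * r * v)).re = 0 := by simp
    rw [this, Real.exp_zero, mul_one]
    exact norm_profile_le h2 h3 r
  have hae : (fun r => g r * eisCT y r) =ᵐ[volume] fun r =>
      g r * Complex.exp (Complex.I * r * v) * (Real.sqrt y : ℂ) +
        g r * scatPhi (critS r) * Complex.exp (-(Complex.I * r * v)) * (Real.sqrt y : ℂ) := by
    have hne : ∀ᵐ r : ℝ, r ≠ 0 := by rw [ae_iff]; simp
    filter_upwards [hne] with r hr
    rw [eisCT_eq hr, cpow_critS_eq hy, cpow_one_sub_critS_eq hy]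
    ring
  unfold packetCT
  rw [integral_congr_ae hae, integral_add (hi1.mul_const _) (hi2.mul_const _), integral_mul_const,
    integral_mul_const, packetA_eq, packetB_eq]
  ring

/-- The remainder integrand is integrable in `r`. [folklore] -/
theorem integrable_profile_mul_eisRem (hg : AEStronglyMeasurable g volume) (hM : ∀ r, ‖g r‖ ≤ M)
    (hR : ∀ r, R < |r| → g r = 0) (z : ℍ) : Integrable (fun r => g r * eisRem z r) volume := by
  have hc : Continuous fun r : ℝ => eisRem z r := by
    unfold eisRem
    refine continuous_critFactor.mul (continuous_const.mul ?_)
    exact (differentiable_csH z).continuous.comp continuous_critS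
  have hy := z.im_pos
  refine (integrable_indicator_const (M * (critFactorSup R * csHConst (z.im / 2))) R).mono' (hg.mul hc.aestronglyMeasurable)
    (Eventually.of_forall fun r => ?_)
  by_cases hr : r ∈ Icc (-R) R
  · rw [indicator_of_mem hr, norm_mul]
    have hrR : |r| ≤ R := abs_le.mpr hr
    have hM0 : 0 ≤ M := le_trans (norm_nonneg _) (hM 0)
    refine mul_le_mul (hM r) ?_ (norm_nonneg _) hM0
    refine (norm_eisRem_le (y₀ := z.im / 2) (by positivity) z (by linarith) r).trans ?_
    have hC := csHConst_nonneg (z.im / 2)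
    have he : Real.exp (-(2 * Real.pi * z.im)) ≤ 1 := Real.exp_le_one_iff.mpr (by nlinarith [Real.pi_pos])
    calc ‖critFactor r‖ * (csHConst (z.im / 2) * Real.exp (-(2 * Real.pi * z.im)))
        ≤ critFactorSup R * (csHConst (z.im / 2) * 1) :=
          mul_le_mul (norm_critFactor_le_critFactorSup hrR) (mul_le_mul_of_nonneg_left he hC) (by positivity)
            (critFactorSup_nonneg (le_trans (abs_nonneg r) hrR))
      _ = critFactorSup R * csHConst (z.im / 2) := by rw [mul_one]
  · rw [indicator_of_notMem hr, hR r (lt_abs_of_not_mem_Icc hr), zero_mul, norm_zero]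

/-- **Packet = constant term + remainder.** [cite: Iwaniec2002, (7.6), PDF p. 69] -/
theorem eisPacket_eq_packetCT_add_packetRem (hg : AEStronglyMeasurable g volume) (hM : ∀ r, ‖g r‖ ≤ M)
    (hR : ∀ r, R < |r| → g r = 0) (z : ℍ) :
    eisPacket g z = packetCT g z.im + packetRem g z := by
  have hrem := integrable_profile_mul_eisRem hg hM hR z
  have hall := integrable_profile_mul_eisensteinCrit hg hM hR z
  have hct : Integrable (fun r => g r * eisCT z.im r) volume := by
    have e : (fun r => g r * eisCT z.im r) = fun r => g r * eisensteinCrit z r - g r * eisRem z r := by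
      funext r; rw [eisensteinCrit_eq_eisCT_add_eisRem]; ring
    rw [e]; exact hall.sub hrem
  unfold eisPacket packetCT packetRem
  rw [← integral_add hct hrem]
  congr 1 with r
  rw [eisensteinCrit_eq_eisCT_add_eisRem]; ring

/-- The constant `C_rem = ∫ M (sup|c|) C(½) 𝟙_{[-R,R]}` bounding the remainder on `𝒟`. [folklore] -/
def packetRemConst (M R : ℝ) : ℝ := ∫ r, (Icc (-R) R).indicator (fun _ : ℝ => M * (critFactorSup R * csHConst (1 / 2))) r

/-- **The remainder is bounded on `𝒟`**: `|∫ g(r) N(z, r) dr| ≤ C_rem`. [folklore] -/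
theorem norm_packetRem_le (hM : ∀ r, ‖g r‖ ≤ M) (hR : ∀ r, R < |r| → g r = 0) {z : ℍ} (hz : z ∈ ModularGroup.fd) :
    ‖packetRem g z‖ ≤ packetRemConst M R := by
  unfold packetRem packetRemConst
  refine norm_integral_le_of_norm_le (integrable_indicator_const _ _) (Eventually.of_forall fun r => ?_)
  by_cases hr : r ∈ Icc (-R) R
  · rw [indicator_of_mem hr, norm_mul]
    have hrR : |r| ≤ R := abs_le.mpr hr
    have hM0 : 0 ≤ M := le_trans (norm_nonneg _) (hM 0)
    refine mul_le_mul (hM r) ?_ (norm_nonneg _) hM0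
    refine (norm_eisRem_le (y₀ := 1 / 2) (by norm_num) z (half_le_im_of_mem_fd hz) r).trans ?_
    have hC := csHConst_nonneg (1 / 2 : ℝ)
    have he : Real.exp (-(2 * Real.pi * z.im)) ≤ 1 := Real.exp_le_one_iff.mpr (by have := z.im_pos; nlinarith [Real.pi_pos])
    calc ‖critFactor r‖ * (csHConst (1 / 2) * Real.exp (-(2 * Real.pi * z.im)))
        ≤ critFactorSup R * (csHConst (1 / 2) * 1) :=
          mul_le_mul (norm_critFactor_le_critFactorSup hrR) (mul_le_mul_of_nonneg_left he hC) (by positivity)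
            (critFactorSup_nonneg (le_trans (abs_nonneg r) hrR))
      _ = critFactorSup R * csHConst (1 / 2) := by rw [mul_one]
  · rw [indicator_of_notMem hr, hR r (lt_abs_of_not_mem_Icc hr), zero_mul, norm_zero]

/-- The constant is non-negative. [folklore] -/
theorem packetRemConst_nonneg (hM : ∀ r, ‖g r‖ ≤ M) (hR : ∀ r, R < |r| → g r = 0) : 0 ≤ packetRemConst M R :=
  le_trans (norm_nonneg _) (norm_packetRem_le (g := g) hM hR (z := UpperHalfPlane.I) (by
    refine ⟨by simp [UpperHalfPlane.I, Complex.normSq], by simp [UpperHalfPlane.I]⟩))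

/-- The substitution `y = e^v`: `∫⁻_{y>0} F(log y) y⁻¹ dy = ∫⁻ F(v) dv`. [folklore] -/
theorem lintegral_Ioi_comp_log_mul_inv (F : ℝ → ℝ≥0∞) :
    ∫⁻ y in Ioi (0 : ℝ), F (Real.log y) * ENNReal.ofReal y⁻¹ = ∫⁻ v, F v := by
  have h := lintegral_image_eq_lintegral_abs_deriv_mul MeasurableSet.univ
    (f := Real.exp) (f' := Real.exp) (fun x _ => (Real.hasDerivAt_exp x).hasDerivWithinAt)
    Real.exp_injective.injOn (fun y => F (Real.log y) * ENNReal.ofReal y⁻¹)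
  rw [Set.image_univ, Real.range_exp, Measure.restrict_univ] at h
  rw [h]
  refine lintegral_congr fun v => ?_
  rw [Real.log_exp, abs_of_pos (Real.exp_pos v), mul_comm (ENNReal.ofReal _), mul_assoc,
    ← ENNReal.ofReal_mul (inv_nonneg.mpr (Real.exp_pos v).le), inv_mul_cancel₀ (Real.exp_pos v).ne',
    ENNReal.ofReal_one, mul_one]

/-- `‖a + b‖² ≤ 2‖a‖² + 2‖b‖²` (a private copy of the tree's `LFunctions.norm_add_sq_le_two`, to keep
the import closure inside the automorphic chain). [folklore] -/
private theorem norm_add_sq_le_two_mul (a b : ℂ) : ‖a + b‖ ^ 2 ≤ 2 * ‖a‖ ^ 2 + 2 * ‖b‖ ^ 2 := by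
  have h := norm_add_le a b
  nlinarith [norm_nonneg a, norm_nonneg b, norm_nonneg (a + b), sq_nonneg (‖a‖ - ‖b‖)]

/-- For `f ∈ L²`, `∫⁻ ‖f‖² < ∞` in the `ofReal` form. [folklore] -/
theorem lintegral_ofReal_norm_sq_lt_top {F : ℝ → ℂ} (hF : MemLp F 2 volume) :
    ∫⁻ v, ENNReal.ofReal (‖F v‖ ^ 2) < ∞ := by
  have h := ((memLp_two_iff_integrable_sq_norm hF.1).1 hF).hasFiniteIntegral
  rw [HasFiniteIntegral] at h
  refine lt_of_le_of_lt (le_of_eq (lintegral_congr fun v => ?_)) h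
  rw [Real.enorm_eq_ofReal (sq_nonneg _)]

/-- **Wave packets are square integrable on the fundamental domain** (Iwaniec, Prop. 7.1, first claim,
"the Eisenstein transform is in `𝔏(Γ\ℍ)`", here for bounded compactly supported profiles over all real
`r`): the remainder is bounded and the constant term `√y(A + B)(log y)` has
`∫_𝒟 |√y(A+B)(log y)|² dμ ≤ ∫₀^∞ |(A+B)(log y)|² dy/y = ∫ |A + B|² dv < ∞` by Plancherel.
[cite: Iwaniec2002, Prop. 7.1 & (7.6), PDF pp. 69–71] -/
theorem memLp_eisPacket (hg : AEStronglyMeasurable g volume) (hM : ∀ r, ‖g r‖ ≤ M)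
    (hR : ∀ r, R < |r| → g r = 0) : MemLp (eisPacket g) 2 μ𝒟 := by
  have hA := memLp_two_packetA hg hM hR
  have hB := memLp_two_packetB hg hM hR
  have hAc := continuous_packetA hg hM hR
  have hBc := continuous_packetB hg hM hR
  set C : ℝ := packetRemConst M R with hCdef
  have hC0 : 0 ≤ C := packetRemConst_nonneg (g := g) hM hR
  -- the measurable majorant of the constant term, as a function of the height
  set h : ℝ → ℝ≥0∞ := fun y => ENNReal.ofReal (‖(Real.sqrt y : ℂ) * (packetA g (Real.log y) + packetB g (Real.log y))‖ ^ 2)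
    with hh
  have hhm : Measurable h := by
    rw [hh]
    refine ENNReal.measurable_ofReal.comp ((Measurable.pow_const ?_ 2))
    refine (Measurable.mul (Complex.measurable_ofReal.comp Real.continuous_sqrt.measurable) ?_).norm
    exact (hAc.measurable.comp Real.measurable_log).add (hBc.measurable.comp Real.measurable_log)
  -- pointwise on `𝒟`: `‖E g‖² ≤ 2 h(Im z) + 2 C²` (in `ℝ≥0∞`)
  have hpt : ∀ z ∈ ModularGroup.fd, ENNReal.ofReal (‖eisPacket g z‖ ^ 2) ≤ 2 * h z.im + ENNReal.ofReal (2 * C ^ 2) := by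
    intro z hz
    rw [eisPacket_eq_packetCT_add_packetRem hg hM hR z, packetCT_eq hg hM hR z.im_pos]
    have hr := norm_packetRem_le (g := g) hM hR hz
    have h2 : ‖packetRem g z‖ ^ 2 ≤ C ^ 2 := pow_le_pow_left₀ (norm_nonneg _) hr 2
    calc ENNReal.ofReal (‖(Real.sqrt z.im : ℂ) * (packetA g (Real.log z.im) + packetB g (Real.log z.im)) + packetRem g z‖ ^ 2)
        ≤ ENNReal.ofReal (2 * ‖(Real.sqrt z.im : ℂ) * (packetA g (Real.log z.im) + packetB g (Real.log z.im))‖ ^ 2 +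
            2 * C ^ 2) := by
          apply ENNReal.ofReal_le_ofReal
          exact (norm_add_sq_le_two_mul _ _).trans (by linarith)
      _ = 2 * h z.im + ENNReal.ofReal (2 * C ^ 2) := by
          rw [ENNReal.ofReal_add (by positivity) (by positivity), ENNReal.ofReal_mul zero_le_two, ENNReal.ofReal_ofNat, hh]
  -- the height integral is finite by Plancherel
  have hfin : ∫⁻ y in Ioi (Real.sqrt 3 / 2), h y * ENNReal.ofReal ((y ^ 2)⁻¹) < ∞ := by
    have hsub : ∫⁻ y in Ioi (Real.sqrt 3 / 2), h y * ENNReal.ofReal ((y ^ 2)⁻¹) ≤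
        ∫⁻ y in Ioi (0 : ℝ), h y * ENNReal.ofReal ((y ^ 2)⁻¹) :=
      lintegral_mono_set (Ioi_subset_Ioi (by positivity))
    refine lt_of_le_of_lt hsub ?_
    have heq : ∀ y ∈ Ioi (0 : ℝ), h y * ENNReal.ofReal ((y ^ 2)⁻¹) =
        ENNReal.ofReal (‖packetA g (Real.log y) + packetB g (Real.log y)‖ ^ 2) * ENNReal.ofReal y⁻¹ := by
      intro y hy
      have hy0 : (0 : ℝ) < y := hy
      simp only [hh]
      rw [norm_mul, Complex.norm_real, Real.norm_of_nonneg (Real.sqrt_nonneg _), mul_pow, Real.sq_sqrt hy0.le,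
        ← ENNReal.ofReal_mul (by positivity), ← ENNReal.ofReal_mul (by positivity)]
      congr 1
      field_simp
    have hchg := lintegral_Ioi_comp_log_mul_inv (fun v => ENNReal.ofReal (‖packetA g v + packetB g v‖ ^ 2))
    rw [setLIntegral_congr_fun measurableSet_Ioi heq, hchg]
    calc ∫⁻ v, ENNReal.ofReal (‖packetA g v + packetB g v‖ ^ 2)
        ≤ ∫⁻ v, (2 * ENNReal.ofReal (‖packetA g v‖ ^ 2) + 2 * ENNReal.ofReal (‖packetB g v‖ ^ 2)) := by
          refine lintegral_mono fun v => ?_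
          rw [← ENNReal.ofReal_ofNat, ← ENNReal.ofReal_mul zero_le_two, ← ENNReal.ofReal_mul zero_le_two,
            ← ENNReal.ofReal_add (by positivity) (by positivity)]
          exact ENNReal.ofReal_le_ofReal (norm_add_sq_le_two_mul _ _)
      _ < ∞ := by
          have m1 : Measurable fun v => ENNReal.ofReal (‖packetA g v‖ ^ 2) :=
            ENNReal.measurable_ofReal.comp (hAc.measurable.norm.pow_const 2)
          have m2 : Measurable fun v => ENNReal.ofReal (‖packetB g v‖ ^ 2) :=
            ENNReal.measurable_ofReal.comp (hBc.measurable.norm.pow_const 2)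
          rw [lintegral_add_left (m1.const_mul 2), lintegral_const_mul 2 m1, lintegral_const_mul 2 m2]
          have h1 := lintegral_ofReal_norm_sq_lt_top hA
          have h2 := lintegral_ofReal_norm_sq_lt_top hB
          have h2top : (2 : ℝ≥0∞) < ∞ := ENNReal.ofNat_lt_top
          exact ENNReal.add_lt_top.mpr ⟨ENNReal.mul_lt_top h2top h1, ENNReal.mul_lt_top h2top h2⟩
  -- assemble
  have hmeas : AEStronglyMeasurable (eisPacket g) μ𝒟 := aestronglyMeasurable_eisPacket hg hM hR
  refine (memLp_two_iff_integrable_sq_norm hmeas).2 ⟨hmeas.norm.pow 2, ?_⟩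
  rw [HasFiniteIntegral]
  calc ∫⁻ z in ModularGroup.fd, ‖‖eisPacket g z‖ ^ 2‖ₑ = ∫⁻ z in ModularGroup.fd, ENNReal.ofReal (‖eisPacket g z‖ ^ 2) := by
        refine lintegral_congr fun z => ?_
        rw [Real.enorm_eq_ofReal (sq_nonneg _)]
    _ ≤ ∫⁻ z in ModularGroup.fd, (2 * h z.im + ENNReal.ofReal (2 * C ^ 2)) := by
        refine lintegral_mono_ae ?_
        filter_upwards [ae_restrict_mem measurableSet_modular_fd] with z hz
        exact hpt z hz
    _ < ∞ := by
        have m1 : Measurable fun z : ℍ => h z.im := hhm.comp UpperHalfPlane.continuous_im.measurable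
        rw [lintegral_add_left (m1.const_mul 2), lintegral_const_mul 2 m1, lintegral_const, Measure.restrict_apply_univ]
        have h2top : (2 : ℝ≥0∞) < ∞ := ENNReal.ofNat_lt_top
        refine ENNReal.add_lt_top.mpr ⟨ENNReal.mul_lt_top h2top ?_,
          ENNReal.mul_lt_top ENNReal.ofReal_lt_top volume_modular_fd_lt_top⟩
        exact lt_of_le_of_lt (lintegral_fd_comp_im_le h hhm) hfin

end MemLp

end Literature.NumberTheory.Automorphic

end
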